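import Mathlib

/-! # The cascade map on finsets of `Fin m`
(seat mine-b, cell pub-perc-repro2; MINE-B.md §24)

`cascade S` shifts every finset one step down along the chains
`[m] ∖ {c} ⊃ [m] ∖ {c, c+1} ⊃ … ⊃ [0, c) ⊃ [1, c) ⊃ … ⊃ {c − 1}` (one chain per `c`) and fixes
every set on no chain: a nonempty linear interval `S = Icc a b` loses its minimum `a`; a set whose
complement is a linear interval `Icc c e` with `c ≠ 0` and `e + 1 < m` (so `S = [0, c) ∪ [e + 1, m)`)
loses `e + 1`; everything else stays.  On the sets of size `2 … m − 1` the map goes down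
(`cascade_subset`), lowers the size by at most one (`card_le_card_cascade_add_one`), never produces a
set of size `m − 1` (`card_cascade_add_one_ne`) and is injective (`cascade_injOn`).  It is the tool
that makes "exactly one red edge" a robust marker of a formerly full bundle in the assignment of
UniversalSeriesBundles.lean. -/

namespace Summit.Ventures.PercRepro2.UHClosure

open Finset

section cascade

variable {m : ℕ}

/-- `S` is a nonempty linear interval -/
def IccCond (S : Finset (Fin m)) : Prop := ∃ a b : Fin m, a ≤ b ∧ S = Finset.Icc a b

/-- the complement of `S` is a nonempty linear interval avoiding `0` and `m - 1` -/
def GapCond (S : Finset (Fin m)) : Prop :=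
  ∃ c e : Fin m, c ≤ e ∧ c.val ≠ 0 ∧ e.val + 1 < m ∧ Sᶜ = Finset.Icc c e

/-- the interval condition is decidable (a bounded search over `Fin m × Fin m`) -/
instance (S : Finset (Fin m)) : Decidable (IccCond S) := by unfold IccCond; infer_instance

/-- the gap condition is decidable (a bounded search over `Fin m × Fin m`) -/
instance (S : Finset (Fin m)) : Decidable (GapCond S) := by unfold GapCond; infer_instance

/-- the cascade map (see the module docstring) -/
def cascade (S : Finset (Fin m)) : Finset (Fin m) :=
  if h : S.Nonempty then
    if IccCond S then S.erase (S.min' h)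
    else if h' : Sᶜ.Nonempty then
      if GapCond S then
        if hv : (Sᶜ.max' h').val + 1 < m then S.erase ⟨(Sᶜ.max' h').val + 1, hv⟩ else S
      else S
    else S
  else S

/-- the cascade of a linear interval removes its minimum -/
lemma cascade_of_icc {S : Finset (Fin m)} (h : S.Nonempty) (hI : IccCond S) :
    cascade S = S.erase (S.min' h) := by
  unfold cascade; rw [dif_pos h, if_pos hI]

/-- the cascade of a set with an interior gap removes the element after the gap -/
lemma cascade_of_gap {S : Finset (Fin m)} (h : S.Nonempty) (hI : ¬ IccCond S) (h' : Sᶜ.Nonempty)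
    (hg : GapCond S) (hv : (Sᶜ.max' h').val + 1 < m) :
    cascade S = S.erase ⟨(Sᶜ.max' h').val + 1, hv⟩ := by
  unfold cascade; rw [dif_pos h, if_neg hI, dif_pos h', if_pos hg, dif_pos hv]

/-- every other set is fixed -/
lemma cascade_of_fixed {S : Finset (Fin m)} (h : S.Nonempty) (hI : ¬ IccCond S) (h' : Sᶜ.Nonempty)
    (hg : ¬ GapCond S) : cascade S = S := by
  unfold cascade; rw [dif_pos h, if_neg hI, dif_pos h', if_neg hg]

/-- the cascade goes down -/
lemma cascade_subset (S : Finset (Fin m)) : cascade S ⊆ S := by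
  unfold cascade
  split_ifs <;> first | exact Finset.erase_subset _ _ | exact Finset.Subset.refl _

/-- the cascade lowers the size by at most one -/
lemma card_le_card_cascade_add_one (S : Finset (Fin m)) : S.card ≤ (cascade S).card + 1 := by
  unfold cascade
  split_ifs with h hI h' hg hv
  · have := Finset.pred_card_le_card_erase (s := S) (a := S.min' h); omega
  · have := Finset.pred_card_le_card_erase (s := S) (a := ⟨(Sᶜ.max' h').val + 1, hv⟩); omega
  · omega
  · omega
  · omega
  · omega

/-- the minimum of a set equal to a nonempty interval -/
lemma min'_eq_of_eq_Icc {T : Finset (Fin m)} {a b : Fin m} (hab : a ≤ b) (hT : T = Finset.Icc a b)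
    (hne : T.Nonempty) : T.min' hne = a :=
  le_antisymm (Finset.min'_le _ _ ((Finset.ext_iff.1 hT a).2 (Finset.left_mem_Icc.2 hab)))
    (Finset.le_min' _ _ _ (fun y hy => (Finset.mem_Icc.1 ((Finset.ext_iff.1 hT y).1 hy)).1))

/-- the maximum of a set equal to a nonempty interval -/
lemma max'_eq_of_eq_Icc {T : Finset (Fin m)} {a b : Fin m} (hab : a ≤ b) (hT : T = Finset.Icc a b)
    (hne : T.Nonempty) : T.max' hne = b :=
  le_antisymm (Finset.max'_le _ _ _ (fun y hy => (Finset.mem_Icc.1 ((Finset.ext_iff.1 hT y).1 hy)).2))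
    (Finset.le_max' _ _ ((Finset.ext_iff.1 hT b).2 (Finset.right_mem_Icc.2 hab)))

/-- two nonempty intervals are equal only if their endpoints are -/
lemma Icc_eq_Icc {a b a' b' : Fin m} (h : a ≤ b) (h' : a' ≤ b')
    (e : Finset.Icc a b = Finset.Icc a' b') : a = a' ∧ b = b' := by
  have h1 : a ∈ Finset.Icc a' b' := (Finset.ext_iff.1 e a).1 (Finset.left_mem_Icc.2 h)
  have h2 : a' ∈ Finset.Icc a b := (Finset.ext_iff.1 e a').2 (Finset.left_mem_Icc.2 h')
  have h3 : b ∈ Finset.Icc a' b' := (Finset.ext_iff.1 e b).1 (Finset.right_mem_Icc.2 h)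
  have h4 : b' ∈ Finset.Icc a b := (Finset.ext_iff.1 e b').2 (Finset.right_mem_Icc.2 h')
  rw [Finset.mem_Icc] at h1 h2 h3 h4
  exact ⟨le_antisymm h2.1 h1.1, le_antisymm h3.2 h4.2⟩

/-- removing the minimum of an interval with at least two elements -/
lemma Icc_erase_left {a b : Fin m} (hab : a < b) (h : a.val + 1 < m) :
    (Finset.Icc a b).erase a = Finset.Icc ⟨a.val + 1, h⟩ b := by
  ext x
  simp only [Finset.mem_erase, Finset.mem_Icc, ne_eq, Fin.ext_iff, Fin.le_iff_val_le_val]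
  have := Fin.lt_def.1 hab
  omega

/-- inserting the element after an interval -/
lemma insert_Icc_succ {c e : Fin m} (hce : c ≤ e) (h : e.val + 1 < m) :
    insert (⟨e.val + 1, h⟩ : Fin m) (Finset.Icc c e) = Finset.Icc c ⟨e.val + 1, h⟩ := by
  ext x
  simp only [Finset.mem_insert, Finset.mem_Icc, Fin.ext_iff, Fin.le_iff_val_le_val]
  have := Fin.le_iff_val_le_val.1 hce
  omega

/-- the complement of a set of size `< m` is nonempty -/
lemma compl_nonempty_of_card {S : Finset (Fin m)} (h : S.card + 1 ≤ m) : Sᶜ.Nonempty := by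
  rw [← Finset.card_pos, Finset.card_compl, Fintype.card_fin]; omega

/-- a fixed point of the cascade satisfies neither condition -/
lemma not_conds_of_cascade_eq {S : Finset (Fin m)} (h : S.Nonempty) (h' : Sᶜ.Nonempty)
    (he : cascade S = S) : ¬ IccCond S ∧ ¬ GapCond S := by
  constructor
  · intro hI
    rw [cascade_of_icc h hI, Finset.erase_eq_self] at he
    exact he (Finset.min'_mem S h)
  · intro hg
    by_cases hI : IccCond S
    · rw [cascade_of_icc h hI, Finset.erase_eq_self] at he
      exact he (Finset.min'_mem S h)
    · obtain ⟨c, e, hce, hc0, hv, hS⟩ := hg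
      have hmax : Sᶜ.max' h' = e := max'_eq_of_eq_Icc hce hS h'
      have hv' : (Sᶜ.max' h').val + 1 < m := by rw [hmax]; exact hv
      rw [cascade_of_gap h hI h' ⟨c, e, hce, hc0, hv, hS⟩ hv', Finset.erase_eq_self] at he
      have hmem : (⟨(Sᶜ.max' h').val + 1, hv'⟩ : Fin m) ∈ Sᶜ := Finset.mem_compl.2 he
      have hmem2 := (Finset.ext_iff.1 hS _).1 hmem
      rw [Finset.mem_Icc] at hmem2
      have := Fin.le_iff_val_le_val.1 hmem2.2
      simp only [hmax] at this
      omega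

/-- the three shapes of a set of size `2 … m − 1` under the cascade -/
lemma cascade_shape (S : Finset (Fin m)) (hne : S.Nonempty) (hc : Sᶜ.Nonempty) (h2 : 2 ≤ S.card) :
    (∃ a b : Fin m, a < b ∧ S = Finset.Icc a b ∧ cascade S = S.erase a) ∨
    (∃ (c e : Fin m) (hv : e.val + 1 < m), c ≤ e ∧ c.val ≠ 0 ∧ Sᶜ = Finset.Icc c e ∧
        cascade S = S.erase ⟨e.val + 1, hv⟩) ∨
    (¬ IccCond S ∧ ¬ GapCond S ∧ cascade S = S) := by
  by_cases hI : IccCond S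
  · left
    obtain ⟨a, b, hab, hS⟩ := hI
    have hlt : a < b := lt_of_le_of_ne hab (fun e => by
      subst e; rw [hS, Finset.Icc_self, Finset.card_singleton] at h2; omega)
    refine ⟨a, b, hlt, hS, ?_⟩
    rw [cascade_of_icc hne ⟨a, b, hab, hS⟩, min'_eq_of_eq_Icc hab hS hne]
  · by_cases hg : GapCond S
    · right; left
      obtain ⟨c, e, hce, hc0, hv, hS⟩ := hg
      have hmax : Sᶜ.max' hc = e := max'_eq_of_eq_Icc hce hS hc
      have hv' : (Sᶜ.max' hc).val + 1 < m := by rw [hmax]; exact hv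
      refine ⟨c, e, hv, hce, hc0, hS, ?_⟩
      rw [cascade_of_gap hne hI hc ⟨c, e, hce, hc0, hv, hS⟩ hv']
      congr 1
      exact Fin.ext (by simp [hmax])
    · right; right
      exact ⟨hI, hg, cascade_of_fixed hne hI hc hg⟩

/-- **the cascade is injective on the sets of size `2 … m − 1`** -/
theorem cascade_injOn {S S' : Finset (Fin m)} (hS : 2 ≤ S.card) (hSm : S.card + 1 ≤ m)
    (hS' : 2 ≤ S'.card) (hS'm : S'.card + 1 ≤ m) (he : cascade S = cascade S') : S = S' := by
  have hne : S.Nonempty := Finset.card_pos.1 (by omega)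
  have hne' : S'.Nonempty := Finset.card_pos.1 (by omega)
  have hc : Sᶜ.Nonempty := compl_nonempty_of_card hSm
  have hc' : S'ᶜ.Nonempty := compl_nonempty_of_card hS'm
  have hm3 : 3 ≤ m := by omega
  rcases cascade_shape S hne hc hS with ⟨a, b, hab, hS1, hcas⟩ | ⟨c, e, hv, hce, hc0, hS1, hcas⟩ |
      ⟨hI, hg, hcas⟩ <;>
    rcases cascade_shape S' hne' hc' hS' with ⟨a', b', hab', hS1', hcas'⟩ |
      ⟨c', e', hv', hce', hc0', hS1', hcas'⟩ | ⟨hI', hg', hcas'⟩ <;>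
    rw [hcas, hcas'] at he
  · -- interval / interval
    have hva : a.val + 1 < m := by
      have := Fin.lt_def.1 hab; have := b.isLt; omega
    have hva' : a'.val + 1 < m := by
      have := Fin.lt_def.1 hab'; have := b'.isLt; omega
    have hlt := Fin.lt_def.1 hab
    have hlt' := Fin.lt_def.1 hab'
    have ha : a ∈ S := (Finset.ext_iff.1 hS1 a).2 (Finset.left_mem_Icc.2 hab.le)
    have ha' : a' ∈ S' := (Finset.ext_iff.1 hS1' a').2 (Finset.left_mem_Icc.2 hab'.le)
    have ha1 : (⟨a.val + 1, hva⟩ : Fin m) ∈ S'.erase a' := by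
      rw [← he, Finset.mem_erase]
      refine ⟨fun h => by rw [Fin.ext_iff] at h; simp at h, ?_⟩
      rw [hS1, Finset.mem_Icc]
      constructor <;> rw [Fin.le_iff_val_le_val] <;> dsimp only <;> omega
    have ha1' : (⟨a'.val + 1, hva'⟩ : Fin m) ∈ S.erase a := by
      rw [he, Finset.mem_erase]
      refine ⟨fun h => by rw [Fin.ext_iff] at h; simp at h, ?_⟩
      rw [hS1', Finset.mem_Icc]
      constructor <;> rw [Fin.le_iff_val_le_val] <;> dsimp only <;> omega
    have haa : a = a' := by
      rcases lt_trichotomy a a' with hl | heq | hr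
      · exfalso
        have h1 := (Finset.mem_erase.1 ha1').2
        rw [hS1, Finset.mem_Icc] at h1
        have h1b := Fin.le_iff_val_le_val.1 h1.2
        have hmem : a' ∈ S.erase a := by
          rw [Finset.mem_erase, hS1, Finset.mem_Icc]
          refine ⟨ne_of_gt hl, hl.le, ?_⟩
          rw [Fin.le_iff_val_le_val]; dsimp only at h1b ⊢; omega
        rw [he, Finset.mem_erase] at hmem
        exact hmem.1 rfl
      · exact heq
      · exfalso
        have h1 := (Finset.mem_erase.1 ha1).2
        rw [hS1', Finset.mem_Icc] at h1
        have h1b := Fin.le_iff_val_le_val.1 h1.2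
        have hmem : a ∈ S'.erase a' := by
          rw [Finset.mem_erase, hS1', Finset.mem_Icc]
          refine ⟨ne_of_gt hr, hr.le, ?_⟩
          rw [Fin.le_iff_val_le_val]; dsimp only at h1b ⊢; omega
        rw [← he, Finset.mem_erase] at hmem
        exact hmem.1 rfl
    subst haa
    calc S = insert a (S.erase a) := (Finset.insert_erase ha).symm
      _ = insert a (S'.erase a) := by rw [he]
      _ = S' := Finset.insert_erase ha'
  · -- interval / gap
    exfalso
    have h0 : (⟨0, by omega⟩ : Fin m) ∈ S' := by
      by_contra hnot
      have h := Finset.mem_compl.2 hnot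
      have h2 := (Finset.ext_iff.1 hS1' _).1 h
      rw [Finset.mem_Icc] at h2
      have h3 := Fin.le_iff_val_le_val.1 h2.1
      dsimp only at h3
      omega
    have h0' : (⟨0, by omega⟩ : Fin m) ∈ S.erase a := by
      rw [he, Finset.mem_erase]
      exact ⟨fun h => by rw [Fin.ext_iff] at h; simp at h, h0⟩
    rw [Finset.mem_erase] at h0'
    obtain ⟨hne0, hmem⟩ := h0'
    have hmem2 := (Finset.ext_iff.1 hS1 _).1 hmem
    rw [Finset.mem_Icc] at hmem2
    have h3 := Fin.le_iff_val_le_val.1 hmem2.1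
    dsimp only at h3
    exact hne0 (Fin.ext (by simp; omega))
  · -- interval / fixed
    exfalso
    apply hI'
    have hva : a.val + 1 < m := by
      have := Fin.lt_def.1 hab; have := b.isLt; omega
    refine ⟨⟨a.val + 1, hva⟩, b, ?_, ?_⟩
    · rw [Fin.le_iff_val_le_val]; dsimp only
      have := Fin.lt_def.1 hab; omega
    · rw [← he, hS1]; exact Icc_erase_left hab hva
  · -- gap / interval
    exfalso
    have h0 : (⟨0, by omega⟩ : Fin m) ∈ S := by
      by_contra hnot
      have h := Finset.mem_compl.2 hnot
      have h2 := (Finset.ext_iff.1 hS1 _).1 h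
      rw [Finset.mem_Icc] at h2
      have h3 := Fin.le_iff_val_le_val.1 h2.1
      dsimp only at h3
      omega
    have h0' : (⟨0, by omega⟩ : Fin m) ∈ S'.erase a' := by
      rw [← he, Finset.mem_erase]
      exact ⟨fun h => by rw [Fin.ext_iff] at h; simp at h, h0⟩
    rw [Finset.mem_erase] at h0'
    obtain ⟨hne0, hmem⟩ := h0'
    have hmem2 := (Finset.ext_iff.1 hS1' _).1 hmem
    rw [Finset.mem_Icc] at hmem2
    have h3 := Fin.le_iff_val_le_val.1 hmem2.1
    dsimp only at h3
    exact hne0 (Fin.ext (by simp; omega))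
  · -- gap / gap
    have hmem : (⟨e.val + 1, hv⟩ : Fin m) ∈ S := by
      by_contra hnot
      have h := Finset.mem_compl.2 hnot
      have h2 := (Finset.ext_iff.1 hS1 _).1 h
      rw [Finset.mem_Icc] at h2
      have h3 := Fin.le_iff_val_le_val.1 h2.2
      dsimp only at h3; omega
    have hmem' : (⟨e'.val + 1, hv'⟩ : Fin m) ∈ S' := by
      by_contra hnot
      have h := Finset.mem_compl.2 hnot
      have h2 := (Finset.ext_iff.1 hS1' _).1 h
      rw [Finset.mem_Icc] at h2
      have h3 := Fin.le_iff_val_le_val.1 h2.2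
      dsimp only at h3; omega
    have hT : (S.erase ⟨e.val + 1, hv⟩)ᶜ = Finset.Icc c ⟨e.val + 1, hv⟩ := by
      rw [Finset.compl_erase, hS1, insert_Icc_succ hce hv]
    have hT' : (S'.erase ⟨e'.val + 1, hv'⟩)ᶜ = Finset.Icc c' ⟨e'.val + 1, hv'⟩ := by
      rw [Finset.compl_erase, hS1', insert_Icc_succ hce' hv']
    have hle : c ≤ ⟨e.val + 1, hv⟩ := by
      rw [Fin.le_iff_val_le_val]; dsimp only; have := Fin.le_iff_val_le_val.1 hce; omega
    have hle' : c' ≤ ⟨e'.val + 1, hv'⟩ := by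
      rw [Fin.le_iff_val_le_val]; dsimp only; have := Fin.le_iff_val_le_val.1 hce'; omega
    obtain ⟨-, hee⟩ := Icc_eq_Icc hle hle' (by rw [← hT, ← hT', he])
    calc S = insert ⟨e.val + 1, hv⟩ (S.erase ⟨e.val + 1, hv⟩) := (Finset.insert_erase hmem).symm
      _ = insert ⟨e'.val + 1, hv'⟩ (S'.erase ⟨e'.val + 1, hv'⟩) := by rw [he, hee]
      _ = S' := Finset.insert_erase hmem'
  · -- gap / fixed
    exfalso
    have hT : S'ᶜ = Finset.Icc c ⟨e.val + 1, hv⟩ := by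
      rw [← he, Finset.compl_erase, hS1, insert_Icc_succ hce hv]
    have hle : c ≤ ⟨e.val + 1, hv⟩ := by
      rw [Fin.le_iff_val_le_val]; dsimp only; have := Fin.le_iff_val_le_val.1 hce; omega
    by_cases hv2 : e.val + 2 < m
    · apply hg'
      exact ⟨c, ⟨e.val + 1, hv⟩, hle, hc0, by dsimp only; omega, hT⟩
    · apply hI'
      refine ⟨⟨0, by omega⟩, ⟨c.val - 1, by omega⟩, ?_, ?_⟩
      · rw [Fin.le_iff_val_le_val]; dsimp only; omega
      · ext x
        have key : x ∈ S' ↔ x ∉ S'ᶜ := by rw [Finset.mem_compl, not_not]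
        rw [key, hT, Finset.mem_Icc, Finset.mem_Icc]
        simp only [Fin.le_iff_val_le_val]
        have := x.isLt; omega
  · -- fixed / interval
    exfalso
    apply hI
    have hva' : a'.val + 1 < m := by
      have := Fin.lt_def.1 hab'; have := b'.isLt; omega
    refine ⟨⟨a'.val + 1, hva'⟩, b', ?_, ?_⟩
    · rw [Fin.le_iff_val_le_val]; dsimp only
      have := Fin.lt_def.1 hab'; omega
    · rw [he, hS1']; exact Icc_erase_left hab' hva'
  · -- fixed / gap
    exfalso
    have hT : Sᶜ = Finset.Icc c' ⟨e'.val + 1, hv'⟩ := by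
      rw [he, Finset.compl_erase, hS1', insert_Icc_succ hce' hv']
    have hle : c' ≤ ⟨e'.val + 1, hv'⟩ := by
      rw [Fin.le_iff_val_le_val]; dsimp only; have := Fin.le_iff_val_le_val.1 hce'; omega
    by_cases hv2 : e'.val + 2 < m
    · apply hg
      exact ⟨c', ⟨e'.val + 1, hv'⟩, hle, hc0', by dsimp only; omega, hT⟩
    · apply hI
      refine ⟨⟨0, by omega⟩, ⟨c'.val - 1, by omega⟩, ?_, ?_⟩
      · rw [Fin.le_iff_val_le_val]; dsimp only; omega
      · ext x
        have key : x ∈ S ↔ x ∉ Sᶜ := by rw [Finset.mem_compl, not_not]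
        rw [key, hT, Finset.mem_Icc, Finset.mem_Icc]
        simp only [Fin.le_iff_val_le_val]
        have := x.isLt; omega
  · -- fixed / fixed
    exact he

/-- a set of size `m - 1` is never fixed by the cascade -/
lemma cascade_ne_self_of_card {S : Finset (Fin m)} (h2 : 2 ≤ S.card) (hm : S.card + 1 = m) :
    cascade S ≠ S := by
  intro he
  have hne : S.Nonempty := Finset.card_pos.1 (by omega)
  have hc : Sᶜ.Nonempty := compl_nonempty_of_card hm.le
  obtain ⟨hI, hg⟩ := not_conds_of_cascade_eq hne hc he
  have hc1 : Sᶜ.card = 1 := by rw [Finset.card_compl, Fintype.card_fin]; omega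
  obtain ⟨x, hx⟩ := Finset.card_eq_one.1 hc1
  have hS : S = univ.erase x := by rw [← compl_compl S, hx, Finset.compl_singleton]
  by_cases h0 : x.val = 0
  · apply hI
    refine ⟨⟨1, by omega⟩, ⟨m - 1, by omega⟩, by rw [Fin.le_iff_val_le_val]; dsimp only; omega, ?_⟩
    ext y
    rw [Finset.ext_iff.1 hS y]
    simp only [Finset.mem_erase, Finset.mem_univ, and_true, Finset.mem_Icc, ne_eq, Fin.ext_iff,
      Fin.le_iff_val_le_val]
    have := y.isLt; omega
  · by_cases hl : x.val + 1 = m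
    · apply hI
      refine ⟨⟨0, by omega⟩, ⟨m - 2, by omega⟩, by rw [Fin.le_iff_val_le_val]; dsimp only; omega, ?_⟩
      ext y
      rw [Finset.ext_iff.1 hS y]
      simp only [Finset.mem_erase, Finset.mem_univ, and_true, Finset.mem_Icc, ne_eq, Fin.ext_iff,
        Fin.le_iff_val_le_val]
      have := y.isLt; omega
    · apply hg
      exact ⟨x, x, le_rfl, h0, by have := x.isLt; omega, by rw [hx, Finset.Icc_self]⟩

/-- **on the sets of size `2 … m − 1` the cascade never produces a set of size `m − 1`** -/
theorem card_cascade_add_one_ne {S : Finset (Fin m)} (h2 : 2 ≤ S.card) (hm : S.card + 1 ≤ m) :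
    (cascade S).card + 1 ≠ m := by
  intro h
  have hsub := cascade_subset S
  have hle := Finset.card_le_card hsub
  have heq : cascade S = S := Finset.eq_of_subset_of_card_le hsub (by omega)
  exact cascade_ne_self_of_card h2 (by omega) heq

end cascade

end Summit.Ventures.PercRepro2.UHClosure
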